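import Summits.AtomisticToContinuum.BoseEinsteinCondensation.Theses.BECInsertionCorrector
import Summits.AtomisticToContinuum.BoseEinsteinCondensation.Theorems.StaticResponseBound.Negative.Basic
import Summits.AtomisticToContinuum.BoseEinsteinCondensation.Theorems.BECInsertionCorrectorStaticResponseBoundSectorFloorToHMinusOnePart1
import Summits.AtomisticToContinuum.BoseEinsteinCondensation.Theorems.BECInsertionCorrectorCorrectorClosureResponseDictionarySymm
import Literature.MathematicalPhysics.QuantumManyBody.GroundStateDirichletForm
import Literature.MathematicalPhysics.QuantumManyBody.WeightedCorrector
import HarnessLib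

/-!
# The moment sandwich `m₋₁ ≤ m₁/ω²` — stub B1 `stub_sectorFloorToHMinusOne`

Helper file for the crux `BECInsertionCorrector.StaticResponseBound` (item
stmt-AtomisticToContinuum-12057), line `stable-fraction-square-completion`: the registered stub **B1**
`stub_sectorFloorToHMinusOne` (brick B1 of the planner's `Lines/fsum-sector-sandwich.lean`, statement
verbatim from the checked skeleton).

For a periodic trial state `Θ` of total momentum `0` (so that the Born weight `|Θ|²` is invariant
under the simultaneous translation `X ↦ X + s𝟙` of all particles) and a floor `0 < ω ≤ ω_Θ(p)` on the
sectorial Poincaré constant of the weight at `p = 2πk/L`, the Kipnis–Varadhan norm of the observable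
`V_p = ∑ⱼ cos(p·xⱼ) = Re ρ̂_p` for the weight `|Θ|` obeys `‖V_p‖²₋₁ ≤ N|p|²/(2ω²)`.

Proof (Feynman–Bijl / Stringari's bound `m₋₁ ≤ m₁/ω²` for the two sum rules, at the level of the
Dirichlet form): by `hMinusOneSqW_le_of_symmetric_tests` it suffices to bound
`2∫V_pβ|Θ|² − 𝓔_{|Θ|}(β)` for Bose-symmetric periodic `C¹` tests `β`, which follows from
`c² ≤ (N|p|²/(2ω²))·𝓔_{|Θ|}(β)`, `c = ∫V_pβ|Θ|²` (`b1_real_algebra`).  Part 1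
(`Theorems/…SectorFloorToHMinusOnePart1.lean`) supplies, in terms of the centre-of-mass Fourier
components `β_q` of `β`, the pairing bound `c² ≤ ‖ρ̂_{±k}‖²_Θ ‖β_{∓k}‖²_Θ` (`b1_pairing_bound`, used
at `k` and at `-k`) and Bessel `𝓔_Θ(β_k) + 𝓔_Θ(β_{-k}) ≤ 𝓔_{|Θ|}(β)` for `k ≠ 0`
(`b1_two_components_le`); here the two Poincaré inequalities at momentum `±p`
(`sectorPoincareConstant_mul_weightedNormSq_le`, `sectorPoincareConstant_neg`; the components are Bloch
test functions, `b1_isBlochTest_component`) give `ω‖β_{±k}‖²_Θ ≤ 𝓔_Θ(β_{±k})` and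
`ω‖ρ̂_{±k}‖²_Θ ≤ 𝓔_Θ(ρ̂_{±k}) = N|p|²` (`groundStateDirichletForm_planeWaveSum`), and `k = 0` is
excluded by the floor (`ω_Θ(0) = 0`).  Adding the two Cauchy–Schwarz bounds:
`2ω²c² ≤ N|p|²(𝓔_Θ(β_k) + 𝓔_Θ(β_{-k})) ≤ N|p|² 𝓔_{|Θ|}(β)`.  No new definitions.
-/

namespace Summit.AtomisticToContinuum.BoseEinsteinCondensation.Cruxes.StaticResponseBound.StableFractionSquareCompletion

open MeasureTheory Filter UnitAddTorus
open scoped ENNReal NNReal ComplexConjugate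
open Literature.MathematicalPhysics.QuantumManyBody.BoseGas
open Summit.AtomisticToContinuum.BoseEinsteinCondensation.Theses
open Summit.AtomisticToContinuum.BoseEinsteinCondensation.Theorems.StaticResponseBound.Negative
open Summit.AtomisticToContinuum.BoseEinsteinCondensation.Theorems.CorrectorClosure.HealingScaleKacInsertion.ResponseDictionary
  (hMinusOneSqW_le_of_symmetric_tests)

noncomputable section

variable {N : ℕ} {L : ℝ}

/-! ### The two Poincaré inequalities, in real form -/

/-- **Poincaré for a sector component**: a floor `ω ≤ ω_Θ(2πq/L)` gives
`ω ∫|φ_q|²|Θ|² ≤ 𝓔_Θ(φ_q)` for the `q`-th component of a symmetric periodic `C¹` function `φ`.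
[folklore] -/
theorem b1_poincare_component (hL : 0 < L) (Θ : PeriodicTrialState N L) {φ : Config N → ℂ}
    (hφ : ContDiff ℝ 1 φ) (hper : IsTorusPeriodic L φ)
    (hsymm : ∀ (σ : Equiv.Perm (Fin N)) (X : Config N), φ (X ∘ σ) = φ X) (q : Fin 3 → ℤ)
    {ω : ℝ} (hω : 0 ≤ ω)
    (hfl : ENNReal.ofReal ω ≤ sectorPoincareConstant L Θ.ψ (latticeVec (2 * Real.pi / L) q)) :
    ω * ∫ X in cellN N L,
        ‖cellFourierCoeff L (fun s => φ (X + fun _ => s)) q‖ ^ 2 * ‖Θ.ψ X‖ ^ 2 ≤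
      (groundStateDirichletForm L Θ.ψ
        (fun X => cellFourierCoeff L (fun s => φ (X + fun _ => s)) q)).toReal := by
  have hB := b1_isBlochTest_component hL hφ hper hsymm q
  have hΘc : Continuous Θ.ψ := Θ.contDiff.continuous
  have hwtop := weightedNormSq_ne_top (L := L) hΘc hB.continuous
  have hEtop := groundStateDirichletForm_ne_top (L := L) hΘc hB.contDiff
  have h1 := (mul_le_mul' hfl le_rfl).trans (sectorPoincareConstant_mul_weightedNormSq_le hB hwtop)
  have h2 := ENNReal.toReal_mono hEtop h1
  rwa [ENNReal.toReal_mul, ENNReal.toReal_ofReal hω, b1_toReal_weightedNormSq L hΘc hB.continuous]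
    at h2

/-- **Poincaré for Feynman's density wave**: a floor `ω ≤ ω_Θ(2πq/L)` gives
`ω ∫|ρ̂_q|²|Θ|² ≤ 𝓔_Θ(ρ̂_q) = N|2πq/L|²` (the f-sum rule numerator,
`groundStateDirichletForm_planeWaveSum`). [folklore] -/
theorem b1_poincare_densityWave (hL : 0 < L) (Θ : PeriodicTrialState N L) (q : Fin 3 → ℤ)
    {ω : ℝ} (hω : 0 ≤ ω)
    (hfl : ENNReal.ofReal ω ≤ sectorPoincareConstant L Θ.ψ (latticeVec (2 * Real.pi / L) q)) :
    ω * ∫ X in cellN N L, ‖densityWave N L q X‖ ^ 2 * ‖Θ.ψ X‖ ^ 2 ≤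
      N * ((2 * Real.pi / L) ^ 2 * ∑ i, (q i : ℝ) ^ 2) := by
  have hB := isBlochTest_planeWaveSum (N := N) hL.ne' q
  have hΘc : Continuous Θ.ψ := Θ.contDiff.continuous
  have hwtop := weightedNormSq_ne_top (L := L) hΘc hB.continuous
  have h1 : ENNReal.ofReal ω * weightedNormSq L Θ.ψ (planeWaveSum L q) ≤
      N * (‖latticeVec (2 * Real.pi / L) q‖₊ : ℝ≥0∞) ^ 2 := by
    calc ENNReal.ofReal ω * weightedNormSq L Θ.ψ (planeWaveSum L q)
        ≤ groundStateDirichletForm L Θ.ψ (planeWaveSum L q) :=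
          (mul_le_mul' hfl le_rfl).trans (sectorPoincareConstant_mul_weightedNormSq_le hB hwtop)
      _ = N * (‖latticeVec (2 * Real.pi / L) q‖₊ : ℝ≥0∞) ^ 2 := by
          rw [groundStateDirichletForm_planeWaveSum, Θ.norm_eq, mul_one]
  have htop : (N : ℝ≥0∞) * (‖latticeVec (2 * Real.pi / L) q‖₊ : ℝ≥0∞) ^ 2 ≠ ⊤ :=
    ENNReal.mul_ne_top (ENNReal.natCast_ne_top N) (ENNReal.pow_ne_top ENNReal.coe_ne_top)
  have h2 := ENNReal.toReal_mono htop h1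
  rw [ENNReal.toReal_mul, ENNReal.toReal_ofReal hω, b1_toReal_weightedNormSq L hΘc hB.continuous,
    ENNReal.toReal_mul, ENNReal.toReal_natCast, ENNReal.toReal_pow, ENNReal.coe_toReal, coe_nnnorm,
    b1_norm_latticeVec_sq] at h2
  refine le_of_eq_of_le ?_ h2
  congr 1
  exact integral_congr_ae (Eventually.of_forall fun X => by
    simp only [secdec_densityWave_eq_planeWaveSum])

/-! ### The real bookkeeping and the registered stub -/

/-- The real bookkeeping of the sandwich: two Cauchy–Schwarz bounds, four Poincaré inequalities and
Bessel give `c² ≤ (P/(2ω²)) E`, hence `2c - E ≤ P/(2ω²)`. [folklore] -/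
theorem b1_real_algebra {c E A A' a a' e e' ω P : ℝ} (hω : 0 < ω) (hP : 0 ≤ P) (hE : 0 ≤ E)
    (ha'0 : 0 ≤ a') (ha0 : 0 ≤ a) (hc : c ^ 2 ≤ A * a') (hc' : c ^ 2 ≤ A' * a)
    (hPA : ω * A ≤ P) (hPA' : ω * A' ≤ P) (hea : ω * a ≤ e) (hea' : ω * a' ≤ e')
    (hsum : e + e' ≤ E) : 2 * c - E ≤ P / (2 * ω ^ 2) := by
  have h1 : ω ^ 2 * c ^ 2 ≤ P * e' :=
    calc ω ^ 2 * c ^ 2 ≤ ω ^ 2 * (A * a') := mul_le_mul_of_nonneg_left hc (sq_nonneg ω)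
      _ = (ω * A) * (ω * a') := by ring
      _ ≤ P * e' := mul_le_mul hPA hea' (mul_nonneg hω.le ha'0) hP
  have h2 : ω ^ 2 * c ^ 2 ≤ P * e :=
    calc ω ^ 2 * c ^ 2 ≤ ω ^ 2 * (A' * a) := mul_le_mul_of_nonneg_left hc' (sq_nonneg ω)
      _ = (ω * A') * (ω * a) := by ring
      _ ≤ P * e := mul_le_mul hPA' hea (mul_nonneg hω.le ha0) hP
  have hPE : P * (e + e') ≤ P * E := mul_le_mul_of_nonneg_left hsum hP
  set C : ℝ := P / (2 * ω ^ 2) with hC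
  have hC0 : 0 ≤ C := by positivity
  have hkey : c ^ 2 ≤ C * E := by
    rw [hC, div_mul_eq_mul_div, le_div_iff₀ (by positivity)]
    nlinarith [h1, h2, hPE]
  by_contra hlt
  rw [not_le] at hlt
  have h3 : 0 < 2 * c - E - C := by linarith
  have h4 : 0 < 2 * c + E + C := by linarith
  nlinarith [mul_pos h3 h4, sq_nonneg (C - E), hkey]

/-- **B1 `stub_sectorFloorToHMinusOne`** (the sandwich `m₋₁ ≤ m₁/ω²`; brick B1 of
`Lines/fsum-sector-sandwich.lean`, statement verbatim from the checked skeleton of the line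
`stable-fraction-square-completion`).  For a periodic trial state `Θ` of total momentum `0`
(translation-invariant Born weight) and a floor `0 < ω ≤ ω_Θ(p)` on the sectorial Poincaré constant
at `p = 2πk/L`, the Kipnis–Varadhan norm of `V_p = ∑ⱼ cos(p·xⱼ)` for the weight `|Θ|` obeys
`‖V_p‖²₋₁ ≤ N|p|²/(2ω²)` (Feynman–Bijl: `m₋₁ ≤ m₁/ω²`, with `m₁ = N|p|²/2` the f-sum rule).
[cite: Stringari1995, §3 (40)] -/
theorem stub_sectorFloorToHMinusOne :
    ∀ (N : ℕ) (L : ℝ), 0 < L → ∀ (k : Fin 3 → ℤ) (Θ : PeriodicTrialState N L),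
      HasTotalMomentum 0 Θ.ψ → ∀ ω : ℝ, 0 < ω →
        ENNReal.ofReal ω ≤ sectorPoincareConstant L Θ.ψ (latticeVec (2 * Real.pi / L) k) →
        hMinusOneSqW L (fun X => ‖Θ.ψ X‖)
            (fun X => ∑ j, Real.cos (2 * Real.pi / L * ∑ i, (k i : ℝ) * X j i)) ≤
          ENNReal.ofReal (N * ((2 * Real.pi / L) ^ 2 * ∑ i, (k i : ℝ) ^ 2) / (2 * ω ^ 2)) := by
  intro N L hL k Θ hΘ ω hω hfl
  -- `k = 0` is excluded by the floor: `ω_Θ(0) = 0 < ω`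
  have hk : k ≠ 0 := by
    rintro rfl
    rw [latticeVec_zero, Θ.sectorPoincareConstant_zero, nonpos_iff_eq_zero,
      ENNReal.ofReal_eq_zero] at hfl
    exact absurd hfl (not_le.2 hω)
  -- the floor at `-k` (`ω_Θ(-p) = ω_Θ(p)`)
  have hfl' : ENNReal.ofReal ω ≤
      sectorPoincareConstant L Θ.ψ (latticeVec (2 * Real.pi / L) (-k)) := by
    have hneg : latticeVec (2 * Real.pi / L) (-k) = -latticeVec (2 * Real.pi / L) k := by
      ext t
      simp only [latticeVec, PiLp.toLp_apply, PiLp.neg_apply, Pi.neg_apply, Int.cast_neg,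
        mul_neg]
    rwa [hneg, sectorPoincareConstant_neg]
  -- symmetric tests suffice
  have hΘc : Continuous Θ.ψ := Θ.contDiff.continuous
  have hVc : Continuous fun X : Config N =>
      ∑ j, Real.cos (2 * Real.pi / L * ∑ i, (k i : ℝ) * X j i) := by fun_prop
  have hVsymm : ∀ (σ : Equiv.Perm (Fin N)) (X : Config N),
      (∑ j, Real.cos (2 * Real.pi / L * ∑ i, (k i : ℝ) * (X ∘ σ) j i)) =
        ∑ j, Real.cos (2 * Real.pi / L * ∑ i, (k i : ℝ) * X j i) := fun σ X =>
    Equiv.sum_comp σ (fun j => Real.cos (2 * Real.pi / L * ∑ i, (k i : ℝ) * X j i))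
  have hFsymm : ∀ (σ : Equiv.Perm (Fin N)) (X : Config N), ‖Θ.ψ (X ∘ σ)‖ = ‖Θ.ψ X‖ :=
    fun σ X => by rw [Θ.symm σ X]
  refine hMinusOneSqW_le_of_symmetric_tests L hVc hVsymm hΘc.norm hFsymm fun β hβ hβsymm => ?_
  beta_reduce
  -- the complexified test function
  have hφ : ContDiff ℝ 1 fun X => (β X : ℂ) := Complex.ofRealCLM.contDiff.comp hβ.contDiff
  have hφper : IsTorusPeriodic L fun X => (β X : ℂ) := fun X i a => by
    simp only [hβ.periodic X i a]
  have hφsymm : ∀ (σ : Equiv.Perm (Fin N)) (X : Config N),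
      ((β (X ∘ σ) : ℝ) : ℂ) = (β X : ℂ) := fun σ X => by rw [hβsymm σ X]
  -- the seven real inequalities
  have hc := b1_pairing_bound N L hL k Θ hΘ β hβ
  have hc' := b1_pairing_bound N L hL (-k) Θ hΘ β hβ
  simp only [neg_neg, Pi.neg_apply, Int.cast_neg, neg_mul, Finset.sum_neg_distrib, mul_neg,
    Real.cos_neg] at hc'
  have hA := b1_poincare_densityWave hL Θ k hω.le hfl
  have hA' := b1_poincare_densityWave hL Θ (-k) hω.le hfl'
  simp only [Pi.neg_apply, Int.cast_neg, neg_sq] at hA'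
  have ha := b1_poincare_component hL Θ hφ hφper hφsymm k hω.le hfl
  have ha' := b1_poincare_component hL Θ hφ hφper hφsymm (-k) hω.le hfl'
  have hE := b1_two_components_le hL Θ hΘ hβ hk
  have hEeq : dirichletFormW L (fun X => ‖Θ.ψ X‖) β β =
      ∫ X in cellN N L, ‖Θ.ψ X‖ ^ 2 * gradDot β β X := by
    rw [dirichletFormW]
    exact integral_congr_ae (ae_of_all _ fun X => by ring)
  rw [hEeq] at hE
  have hE0 : 0 ≤ ∫ X in cellN N L, ‖Θ.ψ X‖ ^ 2 * gradDot β β X :=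
    integral_nonneg fun X => mul_nonneg (sq_nonneg _) (gradDot_self_nonneg β X)
  have hP0 : 0 ≤ (N : ℝ) * ((2 * Real.pi / L) ^ 2 * ∑ i, (k i : ℝ) ^ 2) := by positivity
  exact b1_real_algebra hω hP0 hE0 (integral_nonneg fun X => by positivity)
    (integral_nonneg fun X => by positivity) hc hc' hA hA' ha ha' hE

end

end Summit.AtomisticToContinuum.BoseEinsteinCondensation.Cruxes.StaticResponseBound.StableFractionSquareCompletion
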